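import Literature.NumberTheory.GaloisRepresentations.OrdinaryPolarizedDeformationRingProofs
import Literature.NumberTheory.GaloisRepresentations.LocalPFiniteness
import Literature.NumberTheory.GaloisRepresentations.LocalFieldCountableExtensions
import HarnessLib

/-!
# The universal framed deformation ring `R^□_{𝒪,ρ̄}` of a residual representation of `Γ_K`,
# `K` a `p`-adic field (Mazur §20 Prop. 2; Kisin (2.3.4))

Let `K` be a non-archimedean local field of characteristic `0`, `Γ_K = Gal(K̄/K)`, `𝒪 → k` a
surjection onto a FINITE field `k` (`𝒪` Noetherian; intended `𝒪 = 𝒪_L`, `k = 𝒪_L/λ`) and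
`ρ̄ : Γ_K → GL_n(k)` a continuous (= open-kernel) residual representation.  We PROVE the existence
of the **universal framed deformation ring** (universal lifting ring) of `ρ̄`: an object `R^□` of
Mazur's category `Ĉ_𝒪(k)` of complete Noetherian local `𝒪`-algebras with residue field `k`
together with a continuous lift `ρ^□ : Γ_K → GL_n(R^□)` of `ρ̄` such that every continuous lift of
`ρ̄` to an object `A` of `Ĉ_𝒪(k)` is `φ ∘ ρ^□` for a unique morphism `φ : R^□ → A`
(`Deformation.exists_universalFramedDeformationRing`).  "The functor of framed deformations is
(pro-)representable by a complete local Noetherian `𝒪`-algebra `R^□_{V_𝔽}`" (Kisin 2008, (2.3.4);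
Kisin 2009, §2.3; in Mazur's language: the lifting problem without any condition is representable
for profinite groups satisfying `Φ_p`, [Maz97] §20 Prop. 2 with §21).

The construction is the tree's Mazur representability theorem for lifting conditions
(`Deformation.LiftingCondition.exists_universal_of_finite`, file `DeformationProfiniteLevel`),
applied to

* `Deformation.LiftingCondition.full` — the UNRESTRICTED lifting condition of `ρ̄` (all
  `𝔪_A`-adically continuous lifts; for any topological group `Γ`), whose two inputs for `Γ = Γ_K` are
* `Deformation.LiftingCondition.full_finite_carrier_dualCNL` — finiteness of the lifts of `ρ̄` to
  the dual numbers `k[ε]` (a lift is determined by its values on representatives of `Γ_K / ker ρ̄`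
  and by its tangent map `ker ρ̄ → M_n(k)`, a continuous homomorphism, of which there are finitely
  many by Mazur's `Φ_p` for `Γ_K`, file `LocalPFiniteness`), and
* the cofinal sequence of open normal subgroups of `Γ_K` (file `LocalFieldCountableExtensions`).

We also PROVE, for ANY lifting condition `𝒞` and any universal pair `(R, ρ_R)` for it, that the
matrix entries of `ρ_R` generate a DENSE `𝒪`-subalgebra of `R`
(`Deformation.LiftingCondition.exists_sub_mem_adjoin_of_universal`: "`R` is a quotient of a power
series ring over `𝒪` in the variables `ρ_R(γ)_{ij} - [ρ̄(γ)_{ij}]`", [Maz97] §20 proof of Prop. 2;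
Kisin (2.3.4)): the image `B` of that subalgebra in the finite ring `R/𝔪_R^{m+1}` is again an
object of `Ĉ_𝒪(k)` carrying an admissible lift, and the two morphisms `R → R/𝔪_R^{m+1}` — the
projection and the classifying map of that lift followed by `B ⊆ R/𝔪_R^{m+1}` — coincide by
universality.

Everything is proved; no named facts.

## References

* [Maz97] B. Mazur, *An introduction to the deformation theory of Galois representations*, in
  Modular Forms and Fermat's Last Theorem (Springer 1997), §20 Prop. 2, §21.
  [cite: Mazur1997Deformation, §20 Prop. 2]
* M. Kisin, *Potentially semi-stable deformation rings*, J. Amer. Math. Soc. 21 (2008), (2.3.4)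
  (the universal framed deformation `𝒪`-algebra `R^□_{V_𝔽}` of `V_𝔽 = ρ̄`, `K/ℚ_p` finite).
  [cite: Kisin2007, (2.3.4)]
* M. Kisin, *Moduli of finite flat group schemes, and modularity*, Ann. of Math. 170 (2009), §2.3
  (framed deformations). [cite: KisinModuli2009, §2.3]
-/

noncomputable section

open IsLocalRing Matrix Field

namespace Literature.NumberTheory.GaloisRepresentations.Deformation

universe u

/-! ### The unrestricted lifting condition -/

section Full

variable {𝒪 : Type u} [CommRing 𝒪] {k : Type u} [Field k] [Algebra 𝒪 k]
variable {Γ : Type u} [Group Γ] [TopologicalSpace Γ] [IsTopologicalGroup Γ] {n : ℕ}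
variable (hk : Function.Surjective (algebraMap 𝒪 k))
variable (rbar : Γ →* GL (Fin n) k) (hrbar : IsOpen (rbar.ker : Set Γ))

namespace LiftingCondition

/-- **The unrestricted (full) lifting condition of `ρ̄`**: over each object `A` of `Ĉ_𝒪(k)` ALL
the `𝔪_A`-adically continuous lifts `ρ : Γ → GL_n(A)` of `ρ̄` (`GL_n(π_A) ∘ ρ = ρ̄`).  It satisfies
Mazur's axioms of a lifting (deformation) condition — functoriality (morphisms of `Ĉ_𝒪(k)` are
local, `IsAdicContinuous.comp_map`), `ρ̄ ∈ 𝒞(k)` (the kernel of `ρ̄` is open) and detection by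
jointly injective families (the residual representation is read off any one member).  Its
universal ring, when it exists, is the universal framed deformation ring `R^□_{𝒪,ρ̄}`
(Kisin 2008 (2.3.4); Mazur §20). [cite: Mazur1997Deformation, §20 Prop. 2] [cite: Kisin2007, (2.3.4)] -/
def full : LiftingCondition 𝒪 k Γ n rbar where
  carrier A := {ρ | IsAdicContinuous ρ ∧
    (Matrix.GeneralLinearGroup.map (A.residue : A →+* k)).comp ρ = rbar}
  map_mem := by
    intro A B φ ρ h
    have hπ : (B.residue : B →+* k).comp (φ : A →+* B) = A.residue := by
      ext a; exact CNLAlgebra.residue_map hk φ a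
    refine ⟨h.1.comp_map hk φ, ?_⟩
    rw [← MonoidHom.comp_assoc, ← Matrix.GeneralLinearGroup.map_comp, hπ, h.2]
  self_mem := by
    refine ⟨isAdicContinuous_of_isOpen_ker hrbar, ?_⟩
    change (Matrix.GeneralLinearGroup.map (RingHom.id k)).comp rbar = rbar
    rw [Matrix.GeneralLinearGroup.map_id]; rfl
  residual_eq h := h.2
  isAdicContinuous h := h.1
  mem_of_jointly_injective := by
    intro A ι B φ hinj ρ hcont hmem
    have hne : Nonempty ι := by
      by_contra hι
      rw [not_nonempty_iff] at hι
      exact one_ne_zero (hinj 1 fun i => (IsEmpty.false i).elim)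
    obtain ⟨i₁⟩ := hne
    have hπ : ((B i₁).residue : B i₁ →+* k).comp (φ i₁ : A →+* B i₁) = A.residue := by
      ext a; exact CNLAlgebra.residue_map hk (φ i₁) a
    refine ⟨hcont, ?_⟩
    rw [← hπ, Matrix.GeneralLinearGroup.map_comp, MonoidHom.comp_assoc]
    exact (hmem i₁).2

/-- Membership in the full lifting condition: continuity and reduction to `ρ̄`. [folklore] -/
theorem mem_full_iff {A : CNLAlgebra 𝒪 k} (ρ : Γ →* GL (Fin n) A) :
    ρ ∈ (full hk rbar hrbar).carrier A ↔ IsAdicContinuous ρ ∧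
      (Matrix.GeneralLinearGroup.map (A.residue : A →+* k)).comp ρ = rbar :=
  Iff.rfl

end LiftingCondition

end Full

/-! ### The entries of a universal lift generate a dense subalgebra -/

section Density

variable {𝒪 : Type u} [CommRing 𝒪] {k : Type u} [Field k] [Algebra 𝒪 k] [Finite k]
variable {Γ : Type u} [Group Γ] [TopologicalSpace Γ] [IsTopologicalGroup Γ] {n : ℕ}
  {rbar : Γ →* GL (Fin n) k}
variable (𝒞 : LiftingCondition 𝒪 k Γ n rbar) (hk : Function.Surjective (algebraMap 𝒪 k))

/-- The set of matrix entries `{ρ(γ)_{ij}}` of a homomorphism `ρ : Γ → GL_n(R)`. [folklore] -/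
def entrySet {R : Type*} [CommRing R] (ρ : Γ →* GL (Fin n) R) : Set R :=
  Set.range fun t : Γ × Fin n × Fin n => (ρ t.1).val t.2.1 t.2.2

omit [TopologicalSpace Γ] [IsTopologicalGroup Γ] in
/-- Entries belong to the entry set. [folklore] -/
theorem val_mem_entrySet {R : Type*} [CommRing R] (ρ : Γ →* GL (Fin n) R) (γ : Γ) (i j : Fin n) :
    (ρ γ).val i j ∈ entrySet ρ :=
  ⟨(γ, i, j), rfl⟩

namespace LiftingCondition

variable {𝒞}
variable {R : CNLAlgebra 𝒪 k} {ρR : Γ →* GL (Fin n) R} (hρR : ρR ∈ 𝒞.carrier R)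
  (huniv : ∀ (A : CNLAlgebra 𝒪 k) (ρ : Γ →* GL (Fin n) A), ρ ∈ 𝒞.carrier A →
    ∃! φ : R →ₐ[𝒪] A, (Matrix.GeneralLinearGroup.map (φ : R →+* A)).comp ρR = ρ)

include hk hρR huniv in
/-- **The entries of a universal lift generate a dense `𝒪`-subalgebra.**  Let `(R, ρ_R)` be
universal for the lifting condition `𝒞` (every admissible lift to an object `A` of `Ĉ_𝒪(k)` is
`φ ∘ ρ_R` for a unique `φ : R → A`).  Then for every `m` and every `r ∈ R` there is an
`𝒪`-polynomial `s` in the entries `ρ_R(γ)_{ij}` with `r - s ∈ 𝔪_R^m` — i.e. `R` is a quotient of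
a power series ring over `𝒪` in (finitely many of) the variables `ρ_R(γ)_{ij} - õ_{γ,i,j}`
("the `Λ`-algebra `R` is generated topologically by the matrix entries of the universal
lifting"; Mazur §20, proof of Prop. 2; Kisin 2008 (2.3.4)).  Proof: the image `B` of
`𝒪[entries]` in the finite local ring `R/𝔪_R^{m+1}` is an object of `Ĉ_𝒪(k)` carrying the
admissible lift `ρ_R mod 𝔪_R^{m+1}`; its classifying map `ψ : R → B` followed by `B ⊆ R/𝔪_R^{m+1}`
classifies the same lift as the projection, so the two agree and the projection lands in `B`.
[cite: Mazur1997Deformation, §20 Prop. 2 (proof)] [cite: Kisin2007, (2.3.4)] -/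
theorem exists_sub_mem_adjoin_of_universal (m : ℕ) (r : R) :
    ∃ s ∈ Algebra.adjoin 𝒪 (entrySet ρR), r - s ∈ maximalIdeal R ^ m := by
  classical
  cases m with
  | zero => exact ⟨0, Subalgebra.zero_mem _, by rw [pow_zero, Ideal.one_eq_top]; trivial⟩
  | succ m =>
  -- the finite truncation `T = R/𝔪^{m+1}` and the projection `π`
  set T : CNLAlgebra 𝒪 k := R.trunc m with hT
  set π : R →ₐ[𝒪] T := R.toTrunc m with hπ
  haveI : Finite (ResidueField R) := CNLAlgebra.finite_residueField R
  haveI : Finite (R ⧸ maximalIdeal R) := inferInstanceAs (Finite (ResidueField R))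
  haveI hTfin : Finite T :=
    Ideal.finite_quotient_pow (I := maximalIdeal R) (IsNoetherian.noetherian _) (m + 1)
  -- the image `B` of `𝒪[entries]` in `T`
  set E : Subalgebra 𝒪 R := Algebra.adjoin 𝒪 (entrySet ρR) with hE
  set B : Subalgebra 𝒪 T := E.map π with hB
  haveI : Finite B := Subtype.finite
  -- units of `T` lying in `B` are units of `B` (finite order)
  have hunit : ∀ b : B, IsUnit (b : T) → IsUnit b := by
    intro b hb
    obtain ⟨u, hu⟩ := hb
    obtain ⟨N, hNpos, hN⟩ := (isOfFinOrder_of_finite u).exists_pow_eq_one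
    refine IsUnit.of_pow_eq_one (n := N) ?_ hNpos.ne'
    apply Subtype.ext
    change ((b : T)) ^ N = 1
    rw [← hu, ← Units.val_pow_eq_pow_val, hN, Units.val_one]
  haveI hBloc : IsLocalRing B := by
    refine IsLocalRing.of_isUnit_or_isUnit_one_sub_self fun b => ?_
    rcases IsLocalRing.isUnit_or_isUnit_one_sub_self (b : T) with h | h
    · exact Or.inl (hunit b h)
    · exact Or.inr (hunit (1 - b) (by simpa using h))
  haveI : IsArtinianRing B := isArtinian_of_finite
  -- the maximal ideal of `B` maps into that of `T`, which is nilpotent; so `B` is complete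
  have hmaxle : ∀ b : B, b ∈ maximalIdeal B → (b : T) ∈ maximalIdeal T := by
    intro b hb
    by_contra h
    exact hb (hunit b (not_not.mp (mt (mem_nonunits_iff.mpr) (by rwa [← IsLocalRing.mem_maximalIdeal]))))
  haveI : IsArtinianRing T := isArtinian_of_finite
  obtain ⟨N, hN⟩ : IsNilpotent (maximalIdeal T) := by
    rw [← IsLocalRing.jacobson_eq_maximalIdeal ⊥ bot_ne_top]
    exact IsArtinianRing.isNilpotent_jacobson_bot
  have hBN : maximalIdeal B ^ N = ⊥ := by
    rw [eq_bot_iff]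
    have hle : (maximalIdeal B ^ N).map (B.val : B →+* T) ≤ ⊥ := by
      rw [Ideal.map_pow, ← Ideal.zero_eq_bot, ← hN]
      exact Ideal.pow_right_mono (Ideal.map_le_iff_le_comap.mpr fun b hb => Ideal.mem_comap.mpr (hmaxle b hb)) N
    intro b hb
    have h1 : (B.val : B →+* T) b ∈ (maximalIdeal B ^ N).map (B.val : B →+* T) :=
      Ideal.mem_map_of_mem _ hb
    have h2 : (b : T) = 0 := by simpa using hle h1
    exact (Ideal.mem_bot).mpr (Subtype.ext h2)
  haveI : IsAdicComplete (maximalIdeal B) B := by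
    have hbot : ∀ l, N ≤ l → (maximalIdeal B ^ l • ⊤ : Submodule B B) = ⊥ := fun l hl => by
      rw [smul_eq_mul, Ideal.mul_top]
      exact pow_eq_zero_of_le hl hBN
    haveI : IsHausdorff (maximalIdeal B) B := ⟨fun x hx => by
      have := hx N
      rwa [hbot N le_rfl, SModEq.bot] at this⟩
    haveI : IsPrecomplete (maximalIdeal B) B := ⟨fun f hf => ⟨f N, fun l => by
      rcases le_total l N with hl | hl
      · exact hf hl
      · have := hf hl
        rw [hbot N le_rfl, SModEq.bot] at this
        rw [this]
        exact SModEq.refl _⟩⟩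
    exact ⟨⟩
  -- `B` as an object of `Ĉ_𝒪(k)`
  have hres_surj : Function.Surjective (T.residue.comp B.val) := by
    intro x
    obtain ⟨o, rfl⟩ := hk x
    exact ⟨algebraMap 𝒪 B o, by rw [AlgHom.comp_apply, AlgHom.commutes, AlgHom.commutes]⟩
  let Bc : CNLAlgebra 𝒪 k :=
    { carrier := B
      residue := T.residue.comp B.val
      residue_surjective := hres_surj }
  -- the lift `ρ_R mod 𝔪^{m+1}`, with entries in `B`
  have hmemB : ∀ (γ : Γ) (i j : Fin n), π ((ρR γ).val i j) ∈ B := fun γ i j =>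
    Subalgebra.mem_map.mpr ⟨_, Algebra.subset_adjoin (val_mem_entrySet ρR γ i j), rfl⟩
  let Tm : Γ → Matrix (Fin n) (Fin n) Bc := fun γ => Matrix.of fun i j => ⟨π ((ρR γ).val i j), hmemB γ i j⟩
  have hf : ∀ a : Bc, (∀ _ : PUnit.{u + 1}, (B.val : Bc →+* T) a = 0) → a = 0 := fun a h =>
    Subtype.ext (h PUnit.unit)
  have hρT : ∀ (_ : PUnit.{u + 1}) (γ : Γ),
      ((Matrix.GeneralLinearGroup.map (π : R →+* T)).comp ρR γ).val = (Tm γ).map (B.val : Bc →+* T) := by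
    intro _ γ
    ext i j
    rfl
  let ρB : Γ →* GL (Fin n) Bc :=
    glOfJointlyInjective Tm (fun _ : PUnit.{u + 1} => (B.val : Bc →+* T)) hf
      (fun _ => (Matrix.GeneralLinearGroup.map (π : R →+* T)).comp ρR) hρT
  have hρB_map : (Matrix.GeneralLinearGroup.map ((B.val : Bc →ₐ[𝒪] T) : Bc →+* T)).comp ρB =
      (Matrix.GeneralLinearGroup.map (π : R →+* T)).comp ρR :=
    map_comp_glOfJointlyInjective Tm (fun _ : PUnit.{u + 1} => (B.val : Bc →+* T)) hf
      (fun _ => (Matrix.GeneralLinearGroup.map (π : R →+* T)).comp ρR) hρT PUnit.unit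
  -- `ρ_B` is admissible (detected through the injection `B ⊆ T`)
  have hπmem : (Matrix.GeneralLinearGroup.map (π : R →+* T)).comp ρR ∈ 𝒞.carrier T := 𝒞.map_mem π hρR
  have hvalinj : Function.Injective
      (Matrix.GeneralLinearGroup.map (n := Fin n) ((B.val : Bc →ₐ[𝒪] T) : Bc →+* T)) :=
    generalLinearGroup_map_injective _ Subtype.val_injective
  have hcontB : IsAdicContinuous ρB := by
    intro l
    refine Subgroup.isOpen_mono ?_ ((𝒞.isAdicContinuous hρR) (m + 1))
    intro γ hγ
    rw [MonoidHom.mem_ker, MonoidHom.comp_apply] at hγ ⊢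
    have h1 : ρB γ = 1 := by
      apply hvalinj
      rw [map_one, ← MonoidHom.comp_apply, hρB_map, MonoidHom.comp_apply]
      exact hγ
    rw [h1, map_one]
  have hρBmem : ρB ∈ 𝒞.carrier Bc := by
    refine 𝒞.mem_of_jointly_injective (A := Bc) (ι := PUnit.{u + 1}) (fun _ => T)
      (fun _ => (B.val : Bc →ₐ[𝒪] T)) hf hcontB fun _ => ?_
    rw [hρB_map]
    exact hπmem
  -- universality: the classifying map of `ρ_B`, followed by `B ⊆ T`, is the projection `π`
  obtain ⟨ψ, hψ, -⟩ := huniv Bc ρB hρBmem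
  obtain ⟨φ₀, -, huq⟩ := huniv T _ hπmem
  have hcomp : (B.val : Bc →ₐ[𝒪] T).comp ψ = π := by
    have h1 : (B.val : Bc →ₐ[𝒪] T).comp ψ = φ₀ := by
      refine huq _ ?_
      change (Matrix.GeneralLinearGroup.map
        (((B.val : Bc →ₐ[𝒪] T) : Bc →+* T).comp (ψ : R →+* Bc))).comp ρR = _
      rw [Matrix.GeneralLinearGroup.map_comp, MonoidHom.comp_assoc, hψ, hρB_map]
    have h2 : π = φ₀ := huq _ rfl
    rw [h1, h2]
  -- conclusion
  have hr : π r ∈ B := by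
    have : π r = B.val (ψ r) := by rw [← hcomp]; rfl
    rw [this]
    exact (ψ r).2
  obtain ⟨s, hsE, hs⟩ := Subalgebra.mem_map.mp hr
  refine ⟨s, hsE, ?_⟩
  rw [← CNLAlgebra.toTrunc_eq_zero_iff, map_sub, sub_eq_zero]
  exact hs.symm

end LiftingCondition

end Density

/-! ### `Γ_K`, `K` a `p`-adic field: finiteness of the `k[ε]`-lifts and the universal ring -/

section LocalGalois

variable {K : Type u} [Field K] [ValuativeRel K] [TopologicalSpace K] [IsNonarchimedeanLocalField K]
  [CharZero K]
variable {𝒪 : Type u} [CommRing 𝒪] {k : Type u} [Field k] [Algebra 𝒪 k] [Finite k] {n : ℕ}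
variable (hk : Function.Surjective (algebraMap 𝒪 k))
variable (rbar : absoluteGaloisGroup K →* GL (Fin n) k)
  (hrbar : IsOpen (rbar.ker : Set (absoluteGaloisGroup K)))

namespace LiftingCondition

omit [ValuativeRel K] [TopologicalSpace K] [IsNonarchimedeanLocalField K] [CharZero K] in
/-- On `ker ρ̄` a lift of `ρ̄` to `k[ε]` has `fst`-part `1`. [folklore] -/
theorem full_map_fst_eq_one {ρ : absoluteGaloisGroup K →* GL (Fin n) (dualCNL 𝒪 k)}
    (hρ : ρ ∈ (full hk rbar hrbar).carrier (dualCNL 𝒪 k)) {σ : absoluteGaloisGroup K}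
    (hσ : σ ∈ rbar.ker) : (ρ σ).val.map TrivSqZeroExt.fst = 1 := by
  ext i j
  have h := (full hk rbar hrbar).residue_apply_val hρ σ i j
  rw [MonoidHom.mem_ker] at hσ
  rw [hσ] at h
  exact h

/-- **Finiteness of the lifts of `ρ̄ : Γ_K → GL_n(k)` to the dual numbers `k[ε]`** — Mazur's
`Φ_p`-input of the representability theorem (§20 Prop. 2 with §21: the tangent space
`Hom(ker ρ̄, M_n(k))`-bound) for the unrestricted lifting problem of a residual representation of
`Γ_K`, `K` a `p`-adic field: a lift is determined by its values on representatives of the finite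
set `Γ_K / ker ρ̄` and by its tangent map `σ ↦ ε`-part of `ρ(σ)` on `ker ρ̄`, a continuous
homomorphism `ker ρ̄ → M_n(k)`, of which there are finitely many (`Φ_p` for `Γ_K`,
`finite_contHom_subgroup_of_isOpen`). [cite: Mazur1997Deformation, §21] -/
theorem full_finite_carrier_dualCNL :
    ((full hk rbar hrbar).carrier (dualCNL 𝒪 k)).Finite := by
  classical
  letI : TopologicalSpace (Matrix (Fin n) (Fin n) k) := ⊥
  haveI : DiscreteTopology (Matrix (Fin n) (Fin n) k) := ⟨rfl⟩
  set U := rbar.ker with hU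
  haveI : Finite (absoluteGaloisGroup K ⧸ U) := Subgroup.quotient_finite_of_isOpen U hrbar
  haveI : Finite (GL (Fin n) (dualCNL 𝒪 k)) := Finite.of_injective _ Units.val_injective
  have hfinHom : {f : U → Matrix (Fin n) (Fin n) k | Continuous f ∧ ∀ x y, f (x * y) = f x + f y}.Finite :=
    finite_contHom_subgroup_of_isOpen K U hrbar (Matrix (Fin n) (Fin n) k)
  let Φ : (absoluteGaloisGroup K →* GL (Fin n) (dualCNL 𝒪 k)) →
      (U → Matrix (Fin n) (Fin n) k) × (absoluteGaloisGroup K ⧸ U → GL (Fin n) (dualCNL 𝒪 k)) :=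
    fun ρ => (fun σ => (ρ σ).val.map TrivSqZeroExt.snd, fun q => ρ q.out)
  refine Set.Finite.of_finite_image (f := Φ) ((hfinHom.prod (Set.finite_univ)).subset ?_) ?_
  · rintro _ ⟨ρ, hρ, rfl⟩
    refine ⟨⟨?_, fun σ τ => ?_⟩, Set.mem_univ _⟩
    · have hker := isOpen_ker_of_isAdicContinuous_dualCNL ((full hk rbar hrbar).isAdicContinuous hρ)
      have hc : Continuous fun γ : absoluteGaloisGroup K => (ρ γ).val.map TrivSqZeroExt.snd :=
        continuous_def.2 fun T _ => isOpen_preimage_of_isOpen_ker ρ hker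
          ((fun P : GL (Fin n) (dualCNL 𝒪 k) => P.val.map TrivSqZeroExt.snd) ⁻¹' T)
      exact hc.comp continuous_subtype_val
    · change (ρ (σ.1 * τ.1)).val.map TrivSqZeroExt.snd =
        (ρ σ.1).val.map TrivSqZeroExt.snd + (ρ τ.1).val.map TrivSqZeroExt.snd
      rw [map_mul, Units.val_mul, dualCNL_map_snd_mul, full_map_fst_eq_one hk rbar hrbar hρ σ.2,
        full_map_fst_eq_one hk rbar hrbar hρ τ.2, Matrix.one_mul, Matrix.mul_one, add_comm]
  · intro ρ₁ h₁ ρ₂ h₂ h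
    have hf : (fun σ : U => (ρ₁ σ).val.map TrivSqZeroExt.snd) =
        fun σ : U => (ρ₂ σ).val.map TrivSqZeroExt.snd := congrArg Prod.fst h
    have hq : ∀ q : absoluteGaloisGroup K ⧸ U, ρ₁ q.out = ρ₂ q.out := fun q =>
      congrFun (congrArg Prod.snd h) q
    have hUeq : ∀ u : absoluteGaloisGroup K, u ∈ U → ρ₁ u = ρ₂ u := by
      intro u hu
      apply Units.ext
      refine dualCNL_matrix_ext ?_ ?_
      · rw [full_map_fst_eq_one hk rbar hrbar h₁ hu, full_map_fst_eq_one hk rbar hrbar h₂ hu]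
      · exact congrFun hf ⟨u, hu⟩
    ext γ : 1
    obtain ⟨u, hu⟩ := QuotientGroup.mk_out_eq_mul U γ
    have hγ : γ = (QuotientGroup.mk γ : absoluteGaloisGroup K ⧸ U).out * (u : absoluteGaloisGroup K)⁻¹ := by
      rw [hu, mul_inv_cancel_right]
    rw [hγ, map_mul, map_mul, map_inv, map_inv, hq, hUeq u u.2]

end LiftingCondition

variable [IsNoetherianRing 𝒪]

include hk in
/-- **The universal framed deformation ring of `ρ̄ : Γ_K → GL_n(k)`, `K` a `p`-adic field**
(Mazur §20 Prop. 2 for the unrestricted lifting problem, `Φ_p` holding for `Γ_K`; Kisin 2008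
(2.3.4): "the functor of framed deformations of `V_𝔽` is pro-representable by a complete local
Noetherian `𝒪`-algebra `R^□_{V_𝔽}`").  For `𝒪` Noetherian, `𝒪 → k` onto a finite field `k`,
and `ρ̄` with open kernel, there are an object `R^□` of `Ĉ_𝒪(k)` and a continuous lift
`ρ^□ : Γ_K → GL_n(R^□)` of `ρ̄` such that:
(universality) every `𝔪_A`-adically continuous lift `ρ : Γ_K → GL_n(A)` of `ρ̄` to an object `A`
of `Ĉ_𝒪(k)` is `GL_n(φ) ∘ ρ^□` for a UNIQUE morphism `φ : R^□ → A`; and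
(generation) the entries `ρ^□(γ)_{ij}` generate a dense `𝒪`-subalgebra of `R^□`: every `r ∈ R^□`
is congruent modulo any `𝔪^m` to an `𝒪`-polynomial in the entries.
[cite: Mazur1997Deformation, §20 Prop. 2] [cite: Kisin2007, (2.3.4)] -/
theorem exists_universalFramedDeformationRing (hrbar : IsOpen (rbar.ker : Set (absoluteGaloisGroup K))) :
    ∃ (R : CNLAlgebra 𝒪 k) (ρR : absoluteGaloisGroup K →* GL (Fin n) R),
      (IsAdicContinuous ρR ∧
        (Matrix.GeneralLinearGroup.map (R.residue : R →+* k)).comp ρR = rbar) ∧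
      (∀ (A : CNLAlgebra 𝒪 k) (ρ : absoluteGaloisGroup K →* GL (Fin n) A), IsAdicContinuous ρ →
        (Matrix.GeneralLinearGroup.map (A.residue : A →+* k)).comp ρ = rbar →
          ∃! φ : R →ₐ[𝒪] A, (Matrix.GeneralLinearGroup.map (φ : R →+* A)).comp ρR = ρ) ∧
      ∀ (m : ℕ) (r : R), ∃ s ∈ Algebra.adjoin 𝒪 (entrySet ρR), r - s ∈ maximalIdeal R ^ m := by
  classical
  -- a cofinal sequence of open normal subgroups inside `ker ρ̄`
  obtain ⟨U, hUn, hUo, hUanti, hUle, hUcof⟩ :=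
    exists_antitone_openNormal_seq_le_of_isNonarchimedeanLocalField K rbar.ker hrbar
  haveI : ∀ N, (U N).Normal := hUn
  haveI : ∀ N, Finite (absoluteGaloisGroup K ⧸ U N) := fun N =>
    Subgroup.quotient_finite_of_isOpen _ (hUo N)
  have hUo' : ∀ N ⦃H : Subgroup (absoluteGaloisGroup K)⦄, U N ≤ H →
      IsOpen (H : Set (absoluteGaloisGroup K)) := fun N H hH => Subgroup.isOpen_mono hH (hUo N)
  obtain ⟨R, ρR, hρR, huniv⟩ := (LiftingCondition.full hk rbar hrbar).exists_universal_of_finite hk U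
    hUle hUo' (fun N => hUanti (Nat.le_succ N)) (fun V _ hV => hUcof V hV)
    (LiftingCondition.full_finite_carrier_dualCNL hk rbar hrbar)
  refine ⟨R, ρR, hρR, fun A ρ hc hr => huniv A ρ ⟨hc, hr⟩, fun m r => ?_⟩
  exact LiftingCondition.exists_sub_mem_adjoin_of_universal hk hρR huniv m r

end LocalGalois

end Literature.NumberTheory.GaloisRepresentations.Deformation

end
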